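import Mathlib

/-!
# SoloBlind kernel #210 — variation of constants in the integrating-factor gauge

For a scalar amplitude obeying `a' = λ(B) a + f(B)` (the band-edge pair amplitude of LEMMA R, blueprint
A8/R.1, with `f` the leakage from the fast remainder), the gauge-transformed amplitude
`e^{-Λ(B)} a(B)` with `Λ' = λ` has derivative `e^{-Λ(B)} f(B)`: the homogeneous growth is removed
exactly and only the forcing remains.  Over an interval this integrates to
`a(B) = e^{Λ(B)} (a(0) + ∫₀ᴮ e^{-Λ} f)`, whence the adiabatic bound
`|a(B)| ≤ e^{∫ Re λ} (|a(0)| + ∫ e^{-∫ Re λ} |f|)` used for the pair masses.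
-/

namespace Summit.AnomalousDissipation.AnomalousDissipation.Theorems

open Complex

/-- Gauge identity: if `a' = lam·a + f` at `B` and `Λ' = lam` at `B`, then
`(e^{-Λ} a)' = e^{-Λ(B)} f` at `B`. -/
theorem hasDerivAt_gauge_amplitude (a Λ : ℝ → ℂ) (lam f : ℂ) (B : ℝ)
    (ha : HasDerivAt a (lam * a B + f) B) (hΛ : HasDerivAt Λ lam B) :
    HasDerivAt (fun t => cexp (-Λ t) * a t) (cexp (-Λ B) * f) B := by
  have h1 : HasDerivAt (fun t => cexp (-Λ t)) (cexp (-Λ B) * (-lam)) B := by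
    have := hΛ.neg.cexp
    simpa using this
  have h2 := h1.mul ha
  exact h2.congr_deriv (by ring)

/-- Integrated form (fundamental theorem of calculus): if the gauge identity holds on `[0, B]` with a
continuous forcing term, then `e^{-Λ(B)} a(B) - e^{-Λ(0)} a(0) = ∫₀ᴮ e^{-Λ} f`. -/
theorem gauge_amplitude_integral (a Λ : ℝ → ℂ) (lam f : ℝ → ℂ) (B : ℝ) (hB : 0 ≤ B)
    (ha : ∀ t ∈ Set.Icc 0 B, HasDerivAt a (lam t * a t + f t) t)
    (hΛ : ∀ t ∈ Set.Icc 0 B, HasDerivAt Λ (lam t) t)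
    (hcont : ContinuousOn (fun t => cexp (-Λ t) * f t) (Set.Icc 0 B)) :
    cexp (-Λ B) * a B - cexp (-Λ 0) * a 0 = ∫ t in (0 : ℝ)..B, cexp (-Λ t) * f t := by
  have hderiv : ∀ t ∈ Set.uIcc 0 B,
      HasDerivAt (fun t => cexp (-Λ t) * a t) (cexp (-Λ t) * f t) t := by
    intro t ht
    rw [Set.uIcc_of_le hB] at ht
    exact hasDerivAt_gauge_amplitude a Λ (lam t) (f t) t (ha t ht) (hΛ t ht)
  have hint : IntervalIntegrable (fun t => cexp (-Λ t) * f t) MeasureTheory.volume 0 B := by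
    apply ContinuousOn.intervalIntegrable
    rwa [Set.uIcc_of_le hB]
  rw [intervalIntegral.integral_eq_sub_of_hasDerivAt hderiv hint]

end Summit.AnomalousDissipation.AnomalousDissipation.Theorems
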